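import Literature.IUT.HodgeArakelov.CohomologyLimitKummer
import Literature.IUT.HodgeArakelov.CohomologyLimitComap
import Literature.IUT.HodgeArakelov.CohomologyLimitCongr
import Literature.IUT.HodgeArakelov.TemperedThetaMonoidsProofs3

/-!
# Naturality of the Kummer map into `lim_K H¹(H ⊓ K, A')` under pull-back along `ι : Π₀ → Π` and under transport of
# coefficient actions; the [IUTchII] Cor 3.5 (i)/(ii) input (R) «restriction of constants» DERIVED label-wise

S. Mochizuki, *Inter-universal Teichmüller theory II*, kurims Dec-2020 manuscript: Cor 3.5 (i) p. 94 ("by restricting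
the monoid `Ψ_cns(M^Θ_*)` … via `Π_{v▶} ↠ G_v` … one obtains … `Ψ_cns(M^Θ_*) ⥲ Ψ_cns(M^Θ_*)_{⟨|F_l|⟩}`"), (ii) p. 95,
Prop 3.1 (ii) p. 88 (`Ψ_cns := M_TM`, the Kummer map) [cite: Mochizuki2012, Cor 3.5 (i) p.94]. Claim key DISPUTED
(D-0012). PROOF-ONLY companion (abc-iut cell, layer L6, seat abc-iut-w4-d004 gen 3; node **IUTchII:Cor3.5(ii)**,
restriction-ISO clause, sub-DAG row Cor-35.ii.r12, input (R)). NO definition, NO `Prop` fact, NO instance.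

WHY. abc-iut-w4-d004's restriction-isomorphism files (`…RestrictionIsoKummerGenericProofs`, p424713;
`…UniqueFactorisationProofs`, p429058) produce the Cor 3.5 (ii) isomorphism `Ψ^ι_env ⥲ Ψ_ξ` from the Kummer data, the
theta evaluation (E), `horb`, «`q_{t₀}` non-unit», and the input
**(R) `R_t (κ m) = κ₀ m`**: restricting the Kummer class `κ m ∈ lim_J H¹(Π_Ÿ ∩ J, Π_μ)` of a constant `m ∈ M_TM`
along the evaluation section `s_t : G_v → Π` of ANY label `t` returns the `G_v`-LEVEL Kummer class `κ₀ m`. At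
abc-iut-L6-t1's AbsTopMonoids cohomology model this was derived (p421699) from a pull-back presentation
`κ = proj^* κ₀`; the GENUINE record (`EtaleLevels.thetaEnvRecordKummer`, κ := abc-iut-w4-d007's `h1LimKummerOn`) has no
such presentation. THIS FILE derives (R) there from the NATURALITY OF KUMMER CLASSES:
* `comap_kummerContClass` (fixed level): the pull-back `ContH1.comap ι` (L2) of the continuous Kummer class of `a`
  over `H ≤ Π` is the continuous Kummer class of `a` over `H₀ ≤ Π₀` for the action of `Π₀` on `A` THROUGH `ι`
  (`hact : g • a = ι g • a`) — same root system, same cocycle;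
* `h1LimComap_h1LimKummer` (limits): abc-iut-w4-d004's pull-back `h1LimComap ι` of abc-iut-w4-d007's limit Kummer map
  `h1LimKummer` over `Π` is the limit Kummer map over `Π₀` (coefficient data with the same `hom`);
* `h1LimCongr_h1LimKummer`: transport along an equality `φ₁ = φ₂` of coefficient actions carries the Kummer map for
  `φ₁` to the one for `φ₂`;
* **`restriction_kummerOn_eq_labelwise`**: in the label-wise sections model of the Cor 3.5 (ii) family
  (`…CohomologyModelSectionsProofs` / `…GaloisKummerHomProofs`: restrictions `R_t = h1LimCongr ∘ (j ∘ s_t)^* ∘ ψ`, the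
  record's Kummer map read through `ψ` as `h1LimKummerOn` over `Π`), for sections along which `G_v` acts on `A` in a
  label-independent way (`hact`, cf. Rmk 3.5.2 (iii): the sections are synchronised modulo the kernel of the
  augmentation, which acts trivially), **(R) holds with `κ₀ := h1LimKummerOn` over `G_v`** (coefficient datum
  `c₀` with `c₀.hom = c.hom`) — for every `m ∈ O`, unit or not.
Elementary functoriality of `H¹` [cite: NeukirchSchmidtWingberg2008, I §5]; nothing of [IUTchII] is asserted; no side
taken on [IUTchIII] Cor. 3.12; typed ≠ proved ≠ endorsed.
-/

noncomputable section

namespace Literature.IUT.HodgeArakelov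

open Literature.AnabelianGeometry.EtaleTheta CohomologySystemOfContH1

/-! ### 1. Fixed level: pull-back of a continuous Kummer class is the Kummer class for the pulled-back action -/

section FixedLevel

variable {G₀ G G' : Type*} [Group G₀] [TopologicalSpace G₀] [SeparatelyContinuousMul G₀]
  [Group G] [TopologicalSpace G] [SeparatelyContinuousMul G]
  [Group G'] [TopologicalSpace G'] [IsTopologicalGroup G']
  {φ : G →* G'} {A' : Subgroup G'} [A'.Normal] [IsMulCommutative A']
  {A : Type*} [CommGroup A] [MulDistribMulAction G A] [MulDistribMulAction G₀ A] [TopologicalSpace A]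

/-- **Naturality of continuous Kummer classes under pull-back.** For `ι : Π₀ → Π` continuous with `ι(H₀) ≤ H`, an
action of `Π₀` on `A` that IS the action through `ι` (`hact`), and coefficient data `c` over `Π`, `c₀` over `Π₀` with
the same underlying homomorphism `Λ(A) → A'`: the pull-back `ContH1.comap ι` of the Kummer class of the `H`-invariant
`a` (any compatible root system `x`) is the Kummer class of `a` over `H₀` computed with the same `x`.
[cite: NeukirchSchmidtWingberg2008, I §5] -/
theorem comap_kummerContClass (ι : G₀ →* G) (hι : Continuous ι)
    (hact : ∀ (g : G₀) (a : A), g • a = ι g • a)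
    (c : CyclotomeCoefficients φ A' A) (c₀ : CyclotomeCoefficients (φ.comp ι) A' A)
    (hc : ∀ ζ, c₀.hom ζ = c.hom ζ) {H₀ : Subgroup G₀} {H : Subgroup G} (hle : H₀.map ι ≤ H)
    {a : A} (x : RootSystem a) (ha : a ∈ MulAction.fixedPoints H A)
    (hx : ∀ n : ℕ+, IsOpen (MulAction.stabilizer G (x.root n) : Set G))
    (ha₀ : a ∈ MulAction.fixedPoints H₀ A)
    (hx₀ : ∀ n : ℕ+, IsOpen (MulAction.stabilizer G₀ (x.root n) : Set G₀)) :
    ContH1.comap φ A' ι hι hle (c.kummerContClass H x ha hx) = c₀.kummerContClass H₀ x ha₀ hx₀ := by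
  rw [CyclotomeCoefficients.kummerContClass, CyclotomeCoefficients.kummerContClass, ContH1.comap_mk]
  refine ContH1.mk_congr _ (funext fun y => ?_) _ _
  rw [hc]
  congr 1
  refine Subtype.ext (funext fun n => ?_)
  rw [RootSystem.kummerCocycle_apply, RootSystem.kummerCocycle_apply, Subgroup.smul_def, Subgroup.smul_def, hact]

end FixedLevel

/-! ### 2. Limits: `h1LimComap` and `h1LimCongr` applied to the limit Kummer map -/

section Limit

variable {P₀ P : TopGroup.{0}} {G' : Type} [Group G'] [TopologicalSpace G'] [IsTopologicalGroup G']
  (φ : P →* G') (A' : Subgroup G') [A'.Normal] [IsMulCommutative A'] (H : Subgroup P)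
  {A : Type} [CommGroup A] [MulDistribMulAction P A] [MulDistribMulAction P₀ A] [TopologicalSpace A]
  [RootableBy A ℕ]
  (c : CyclotomeCoefficients φ A' A)
  (hA : ∀ b : A, IsOpen (MulAction.stabilizer P b : Set P))
  (hfi : ∀ b : A, (MulAction.stabilizer P b).FiniteIndex)
  (ι : P₀ →* P) (hι : Continuous ι) {H₀ : Subgroup P₀}

omit [TopologicalSpace A] [RootableBy A ℕ] in
/-- `H₀ ∩ ι⁻¹K` fixes `b` whenever `H ∩ K` does, the action of `Π₀` being through `ι`.
[cite: NeukirchSchmidtWingberg2008, I §5] -/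
theorem mem_fixedPoints_inf_comap (hH : H₀.map ι ≤ H) (hact : ∀ (g : P₀) (a : A), g • a = ι g • a)
    (i : Idx (P := P) ⊥) {b : A} (hb : b ∈ MulAction.fixedPoints ↥(H ⊓ i.K) A) :
    b ∈ MulAction.fixedPoints ↥(H₀ ⊓ (Idx.comap ι hι i).K) A := by
  intro h
  rw [Subgroup.smul_def, hact]
  exact hb ⟨ι (h : P₀), hH ⟨(h : P₀), h.2.1, rfl⟩, h.2.2⟩

include hA hι in
omit [TopologicalSpace A] [RootableBy A ℕ] in
/-- Open stabilisers pull back to open stabilisers (`Stab_{Π₀}(b) = ι⁻¹ Stab_Π(b)`, `ι` continuous).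
[cite: NeukirchSchmidtWingberg2008, I §5] -/
theorem isOpen_stabilizer_comap (hact : ∀ (g : P₀) (a : A), g • a = ι g • a) (b : A) :
    IsOpen (MulAction.stabilizer P₀ b : Set P₀) := by
  have h : (MulAction.stabilizer P₀ b : Set P₀) = ι ⁻¹' (MulAction.stabilizer P b : Set P) := by
    ext g
    simp only [SetLike.mem_coe, MulAction.mem_stabilizer_iff, Set.mem_preimage, hact]
  rw [h]
  exact (hA b).preimage hι

/-- **Naturality of the limit Kummer map under pull-back**: abc-iut-w4-d004's `h1LimComap ι` (pull-back of
`lim_K H¹(H ⊓ K, A')` along `ι : Π₀ → Π`, `ι(H₀) ≤ H`) carries abc-iut-w4-d007's Kummer class `κ_Π(b)` to the Kummer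
class `κ_{Π₀}(b)` for the action of `Π₀` through `ι` — computed at the level `Stab_Π(b)` and its pull-back.
[cite: NeukirchSchmidtWingberg2008, I §5] -/
theorem h1LimComap_h1LimKummer (hH : H₀.map ι ≤ H) (hact : ∀ (g : P₀) (a : A), g • a = ι g • a)
    (c₀ : CyclotomeCoefficients (φ.comp ι) A' A) (hc : ∀ ζ, c₀.hom ζ = c.hom ζ)
    (hA₀ : ∀ b : A, IsOpen (MulAction.stabilizer P₀ b : Set P₀))
    (hfi₀ : ∀ b : A, (MulAction.stabilizer P₀ b).FiniteIndex) (b : A) :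
    h1LimComap φ A' ι hι hH (Multiplicative.toAdd (h1LimKummer φ A' H c hA hfi b)) =
      Multiplicative.toAdd (h1LimKummer (φ.comp ι) A' H₀ c₀ hA₀ hfi₀ b) := by
  have hb := mem_fixedPoints_stabIdx H hA hfi b
  have hb₀ := mem_fixedPoints_inf_comap H ι hι hH hact (stabIdx hA hfi b) hb
  rw [h1LimKummer_eq_h1Of_kummerContClass φ A' H c hA hfi b (stabIdx hA hfi b) hb (RootSystem.ofRootableBy b),
    h1LimKummer_eq_h1Of_kummerContClass (φ.comp ι) A' H₀ c₀ hA₀ hfi₀ b (Idx.comap ι hι (stabIdx hA hfi b)) hb₀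
      (RootSystem.ofRootableBy b),
    toAdd_ofAdd, toAdd_ofAdd, h1LimComap_of]
  refine congrArg (h1Of (φ.comp ι) A' H₀ ⊥ (Idx.comap ι hι (stabIdx hA hfi b))) ?_
  change Additive.ofMul (ContH1.comap φ A' ι hι (inf_comap_map_le ι hι hH (stabIdx hA hfi b))
      (c.kummerContClass (H ⊓ (stabIdx hA hfi b).K) (RootSystem.ofRootableBy b) hb fun _ => hA _)) = _
  rw [comap_kummerContClass ι hι hact c c₀ hc (inf_comap_map_le ι hι hH (stabIdx hA hfi b))
    (RootSystem.ofRootableBy b) hb (fun _ => hA _) hb₀ (fun _ => hA₀ _)]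

/-- The same for the Kummer map restricted to a submonoid `O ≤ A` (`h1LimKummerOn`, "`Ψ_cns := M_TM`").
[cite: Mochizuki2012, Prop 3.1 (ii) p.88] -/
theorem h1LimComap_h1LimKummerOn (hH : H₀.map ι ≤ H) (hact : ∀ (g : P₀) (a : A), g • a = ι g • a)
    (c₀ : CyclotomeCoefficients (φ.comp ι) A' A) (hc : ∀ ζ, c₀.hom ζ = c.hom ζ)
    (hA₀ : ∀ b : A, IsOpen (MulAction.stabilizer P₀ b : Set P₀))
    (hfi₀ : ∀ b : A, (MulAction.stabilizer P₀ b).FiniteIndex) (O : Submonoid A) (m : O) :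
    h1LimComap φ A' ι hι hH (Multiplicative.toAdd (h1LimKummerOn φ A' H c hA hfi O m)) =
      Multiplicative.toAdd (h1LimKummerOn (φ.comp ι) A' H₀ c₀ hA₀ hfi₀ O m) := by
  rw [h1LimKummerOn_apply, h1LimKummerOn_apply]
  exact h1LimComap_h1LimKummer φ A' H c hA hfi ι hι hH hact c₀ hc hA₀ hfi₀ m

end Limit

section Congr

variable {P : TopGroup.{0}} {G' : Type} [Group G'] [TopologicalSpace G'] [IsTopologicalGroup G']
  {φ₁ φ₂ : P →* G'} (A' : Subgroup G') [A'.Normal] [IsMulCommutative A'] (H : Subgroup P)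
  {A : Type} [CommGroup A] [MulDistribMulAction P A] [TopologicalSpace A] [RootableBy A ℕ]
  (hA : ∀ b : A, IsOpen (MulAction.stabilizer P b : Set P))
  (hfi : ∀ b : A, (MulAction.stabilizer P b).FiniteIndex)

/-- **Transport along `φ₁ = φ₂` carries the Kummer map for `φ₁` to the Kummer map for `φ₂`** (coefficient data with
the same underlying homomorphism). [cite: NeukirchSchmidtWingberg2008, I §5] -/
theorem h1LimCongr_h1LimKummer (h : φ₁ = φ₂) (c₁ : CyclotomeCoefficients φ₁ A' A)
    (c₂ : CyclotomeCoefficients φ₂ A' A) (hc : ∀ ζ, c₁.hom ζ = c₂.hom ζ) (b : A) :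
    h1LimCongr A' H h ⊥ (Multiplicative.toAdd (h1LimKummer φ₁ A' H c₁ hA hfi b)) =
      Multiplicative.toAdd (h1LimKummer φ₂ A' H c₂ hA hfi b) := by
  subst h
  have hc' : c₁ = c₂ := by
    cases c₁
    cases c₂
    congr
    exact MonoidHom.ext hc
  subst hc'
  rfl

/-- The same for `h1LimKummerOn`. [cite: Mochizuki2012, Prop 3.1 (ii) p.88] -/
theorem h1LimCongr_h1LimKummerOn (h : φ₁ = φ₂) (c₁ : CyclotomeCoefficients φ₁ A' A)
    (c₂ : CyclotomeCoefficients φ₂ A' A) (hc : ∀ ζ, c₁.hom ζ = c₂.hom ζ) (O : Submonoid A) (m : O) :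
    h1LimCongr A' H h ⊥ (Multiplicative.toAdd (h1LimKummerOn φ₁ A' H c₁ hA hfi O m)) =
      Multiplicative.toAdd (h1LimKummerOn φ₂ A' H c₂ hA hfi O m) := by
  rw [h1LimKummerOn_apply, h1LimKummerOn_apply]
  exact h1LimCongr_h1LimKummer A' H hA hfi h c₁ c₂ hc m

end Congr

/-! ### 3. (R) in the label-wise sections model of [IUTchII] Cor 3.5 (ii) -/

section Labelwise

open TemperedThetaMonoids

variable {Q : Type} [Group Q] (E : TemperedThetaMonoids.ThetaEnvData.{0, 0} Q)
  {P₀ P : TopGroup.{0}} {G' : Type} [Group G'] [TopologicalSpace G'] [IsTopologicalGroup G']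
  (φ : P →* G') (φ₀ : P₀ →* G') (Am : Subgroup G') [Am.Normal] [IsMulCommutative Am] (N : Subgroup P)
  {A : Type} [CommGroup A] [MulDistribMulAction P A] [MulDistribMulAction P₀ A] [TopologicalSpace A]
  [RootableBy A ℕ]
  (c : CyclotomeCoefficients φ Am A)
  (hA : ∀ b : A, IsOpen (MulAction.stabilizer P b : Set P))
  (hfi : ∀ b : A, (MulAction.stabilizer P b).FiniteIndex)
  (c₀ : CyclotomeCoefficients φ₀ Am A)
  (hA₀ : ∀ b : A, IsOpen (MulAction.stabilizer P₀ b : Set P₀))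
  (hfi₀ : ∀ b : A, (MulAction.stabilizer P₀ b).FiniteIndex)
  (O : Submonoid A) (κ : O →* E.H)
  (j : Q →* P) (ψ : Additive E.H ≃+ h1Lim φ Am N ⊥) {L : Type*} (s : L → (P₀ →* Q))
  (hι : ∀ t, Continuous (j.comp (s t))) (hN : ∀ t, (⊤ : Subgroup P₀).map (j.comp (s t)) ≤ N)
  (hφ : ∀ t, φ.comp (j.comp (s t)) = φ₀)

omit [IsTopologicalGroup G'] [IsMulCommutative Am] [RootableBy A ℕ] in
/-- Coefficient data over `G_v` for the pulled-back action `φ ∘ j ∘ s_t`, with the same underlying homomorphism as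
`c` — exists (equivariance from `hact` and that of `c`); recorded as an existence statement so that no datum is
defined in this proof-only file. [cite: NeukirchSchmidtWingberg2008, I §5] -/
theorem exists_cyclotomeCoefficients_section (hact : ∀ (t : L) (g : P₀) (a : A), g • a = j (s t g) • a) (t : L) :
    ∃ ct : CyclotomeCoefficients (φ.comp (j.comp (s t))) Am A, ∀ ζ, ct.hom ζ = c.hom ζ := by
  refine ⟨⟨c.hom, c.continuous_hom, fun g ζ => ?_⟩, fun _ => rfl⟩
  have hζ : g • ζ = (j (s t g)) • ζ :=
    Subtype.ext (funext fun n => by rw [cyclotome.coe_smul, cyclotome.coe_smul, Pi.smul_apply, Pi.smul_apply, hact])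
  rw [hζ, c.hom_smul]
  rfl

/-- **(R) «restriction of constants» DERIVED in the label-wise sections model of [IUTchII] Cor 3.5 (i)/(ii)**
("by restricting the monoid `Ψ_cns(M^Θ_*)` … via `Π_{v▶} ↠ G_v`", p. 94): with restrictions
`R_t = h1LimCongr ∘ (j ∘ s_t)^* ∘ ψ` along the evaluation sections (as in `…CohomologyModelSectionsProofs`), the
record's Kummer map `κ` read through `ψ` as abc-iut-w4-d007's `h1LimKummerOn` over `Π` (`hψκ`; `rfl` at the genuine
record), and `G_v` acting on `A` label-independently through the sections (`hact`), the restriction of the Kummer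
class of EVERY constant `m ∈ O` — unit or not — is the `G_v`-level Kummer class: `R_t (κ m) = κ₀ m` with
`κ₀ := h1LimKummerOn` over `G_v` (any coefficient datum `c₀` with `c₀.hom = c.hom`). [cite: Mochizuki2012, Cor 3.5 (i) p.94] -/
theorem restriction_kummerOn_eq_labelwise (hc₀ : ∀ ζ, c₀.hom ζ = c.hom ζ)
    (hact : ∀ (t : L) (g : P₀) (a : A), g • a = j (s t g) • a)
    (hψκ : ∀ m : O, ψ (Additive.ofMul (κ m)) = Multiplicative.toAdd (h1LimKummerOn φ Am N c hA hfi O m))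
    (R : L → (E.H →* Multiplicative (h1Lim φ₀ Am (⊤ : Subgroup P₀) ⊥)))
    (hR : ∀ t y, Multiplicative.toAdd (R t y) =
      h1LimCongr Am ⊤ (hφ t) ⊥ (h1LimComap φ Am (j.comp (s t)) (hι t) (hN t) (ψ (Additive.ofMul y))))
    (t : L) (m : O) :
    R t (κ m) = h1LimKummerOn φ₀ Am ⊤ c₀ hA₀ hfi₀ O m := by
  obtain ⟨ct, hct⟩ := exists_cyclotomeCoefficients_section φ Am c j s hact t
  apply Multiplicative.toAdd.injective
  rw [hR, hψκ, h1LimComap_h1LimKummerOn φ Am N c hA hfi (j.comp (s t)) (hι t) (hN t) (hact t) ct hct hA₀ hfi₀ O m]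
  exact h1LimCongr_h1LimKummerOn Am ⊤ hA₀ hfi₀ (hφ t) ct c₀ (fun ζ => (hct ζ).trans (hc₀ ζ).symm) O m

/-- (R) in the hypothesis shape `hRκ` of abc-iut-w4-d004's `exists_unique_restrictionIso'_ofKummer_gen` (restrictions
composed with the inclusion of the theta monoid `Ψ^ι_env`). [cite: Mochizuki2012, Cor 3.5 (ii) p.95] -/
theorem restriction_kummerOn_eq_labelwise' {ι₁ : E.Iota} (hc₀ : ∀ ζ, c₀.hom ζ = c.hom ζ)
    (hact : ∀ (t : L) (g : P₀) (a : A), g • a = j (s t g) • a)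
    (hψκ : ∀ m : O, ψ (Additive.ofMul (κ m)) = Multiplicative.toAdd (h1LimKummerOn φ Am N c hA hfi O m))
    (R : L → (E.H →* Multiplicative (h1Lim φ₀ Am (⊤ : Subgroup P₀) ⊥)))
    (hR : ∀ t y, Multiplicative.toAdd (R t y) =
      h1LimCongr Am ⊤ (hφ t) ⊥ (h1LimComap φ Am (j.comp (s t)) (hι t) (hN t) (ψ (Additive.ofMul y))))
    (t : L) (m : O) (hm : κ m ∈ E.thetaMonoid ι₁) :
    ((R t).comp (E.thetaMonoid ι₁).subtype) ⟨κ m, hm⟩ = h1LimKummerOn φ₀ Am ⊤ c₀ hA₀ hfi₀ O m :=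
  restriction_kummerOn_eq_labelwise E φ φ₀ Am N c hA hfi c₀ hA₀ hfi₀ O κ j ψ s hι hN hφ hc₀ hact hψκ R hR t m

end Labelwise

end Literature.IUT.HodgeArakelov

end
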